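import Literature.AlgebraicGeometry.Resolution.PlaneChartEndomorphism
import Literature.AlgebraicGeometry.Resolution.QuadraticTransformColength
import Literature.RingTheory.Length.ColengthFinrank
import Literature.RingTheory.MvPowerSeries.FiniteColength
import HarnessLib

/-!
# Colength of the weak transform under the chart endomorphism of `κ⟦x, y⟧` (Huneke–Swanson 14.3.4, counted over `κ`)

`Literature/AlgebraicGeometry/Resolution/PlaneChartColength.lean`. Let `R = κ⟦X₀, X₁⟧`, `i ≠ j`,
`t ∈ κ`, and `Θ` the chart endomorphism `X i ↦ X i`, `X j ↦ X i (X j + t)` of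
`PlaneChartEndomorphism.lean` (blow up the closed point, chart `X i`, translate by `t`). For an ideal
`J ≤ 𝔪ʳ` (`r ≥ 1`) of finite colength containing some `f ∉ (X i) + 𝔪ʳ⁺¹` (an element of order `r`
whose initial form is prime to `X i`), and an ideal `J'` with `Θ(J)·R = X i ^ r · J'` (the WEAK
TRANSFORM of `J` at the point `t` of the exceptional line), we prove

* `finrank_quotient_weakTransform_add_le` — `dim_κ R/J' + dim_κ R/𝔪ʳ ≤ dim_κ R/J^c`, where
  `J^c = J S ∩ R ⊇ J` is the contraction of `J` from the chart ring `S = ⋃ₙ 𝔪ⁿ/xⁿ` (realised inside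
  `R` through `Θ`): this is Huneke–Swanson's Lemma 14.3.4 (`λ(S/J^S) = λ(𝔪ʳ/J^c)`), composed with the
  surjection `S ↠ R/J'`;
* `nonempty_quotient_colon_equiv` — the `κ`-linear isomorphism `B/J^B ≅ 𝔪ʳ/J^c` behind it
  (`J^B = (J B : xʳ)` the transform in the chart algebra `B`).

The strict drop for two-generated ideals (`J ⊊ J^c`) is in `PlaneChartColengthDrop.lean`; together
they are the colength engine of the one-blow-up Milnor-number drop for the gradient ideal of a plane
formal function (crux `ClassicalRegimes` of summit `ResolutionOfSingularities`). Everything is PROVED;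
no definitions (the chart ring is the subalgebra `{s | ∃ n, ∃ b ∈ 𝔪ⁿ, Θ b = xⁿ s}` of `R`,
produced by `exists_chartSubalgebra` and consumed through its membership characterisation).

## References
* [HunekeSwanson2006] C. Huneke, I. Swanson, Integral Closure of Ideals, Rings, and Modules, CUP 2006,
  Lemma 14.3.4, Prop. 14.1.7, §14.1.
* [ZariskiSamuel1960] O. Zariski, P. Samuel, Commutative Algebra II, 1960, Appendix 5.
-/

noncomputable section

open MvPowerSeries IsLocalRing Finsupp Module
open Literature.RingTheory.MvPowerSeries.Jets Literature.RingTheory.Length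

namespace Literature.AlgebraicGeometry.Resolution.PlaneChart

universe u

variable {κ : Type u} [Field κ]

/-! ### Elementary facts about `κ⟦X₀, X₁⟧` -/

/-- `X i ∉ 𝔪²`. [folklore] -/
theorem X_not_mem_maximalIdeal_sq (i : Fin 2) :
    (X i : MvPowerSeries (Fin 2) κ) ∉ maximalIdeal (MvPowerSeries (Fin 2) κ) ^ 2 := by
  classical
  intro h
  have := coeff_eq_zero_of_mem_maximalIdeal_pow h (e := single i 1) (by simp)
  rw [coeff_X, if_pos rfl] at this
  exact one_ne_zero this

/-- The variables of `κ⟦X₀, X₁⟧` are non-zero. [folklore] -/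
theorem X_ne_zero' (i : Fin 2) : (X i : MvPowerSeries (Fin 2) κ) ≠ 0 := by
  classical
  intro h
  have := congrArg (coeff (single i 1)) h
  rw [coeff_X, if_pos rfl, map_zero] at this
  exact one_ne_zero this

/-- An ideal of `κ⟦X₀, X₁⟧` containing a power of the maximal ideal has finite colength. [folklore] -/
theorem finite_quotient_of_pow_le {N : ℕ} {J : Ideal (MvPowerSeries (Fin 2) κ)}
    (h : maximalIdeal (MvPowerSeries (Fin 2) κ) ^ N ≤ J) :
    Module.Finite κ (MvPowerSeries (Fin 2) κ ⧸ J) :=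
  haveI := finite_quotient_maximalIdeal_pow (σ := Fin 2) (K := κ) N
  finite_quotient_of_le (κ := κ) h

section Chart

variable {i j : Fin 2} (hij : j ≠ i) (t : κ)
  (Θ : MvPowerSeries (Fin 2) κ →ₐ[κ] MvPowerSeries (Fin 2) κ)
  (hΘi : Θ (X i) = X i) (hΘj : Θ (X j) = X i * (X j + C t))

/-! ### The chart ring `S = ⋃ₙ 𝔪ⁿ/xⁿ` realised inside `R` through `Θ` -/

include hΘi in
/-- **The chart subalgebra.** The subset `{s | ∃ n, ∃ b ∈ 𝔪ⁿ, Θ b = (X i)ⁿ s}` of `κ⟦X₀, X₁⟧` is a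
`κ`-subalgebra. [folklore] -/
theorem exists_chartSubalgebra :
    ∃ B : Subalgebra κ (MvPowerSeries (Fin 2) κ), ∀ s, s ∈ B ↔
      ∃ (n : ℕ) (b : MvPowerSeries (Fin 2) κ),
        b ∈ maximalIdeal (MvPowerSeries (Fin 2) κ) ^ n ∧ Θ b = X i ^ n * s := by
  have hx1 : (X i : MvPowerSeries (Fin 2) κ) ∈ maximalIdeal _ := X_mem_maximalIdeal κ (Fin 2) i
  refine ⟨{ carrier := {s | ∃ (n : ℕ) (b : MvPowerSeries (Fin 2) κ),
              b ∈ maximalIdeal (MvPowerSeries (Fin 2) κ) ^ n ∧ Θ b = X i ^ n * s}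
            mul_mem' := ?_, one_mem' := ?_, add_mem' := ?_, zero_mem' := ?_,
            algebraMap_mem' := ?_ }, fun s => Iff.rfl⟩
  · rintro s s' ⟨n, b, hb, hbs⟩ ⟨n', b', hb', hbs'⟩
    refine ⟨n + n', b * b', ?_, ?_⟩
    · rw [pow_add]; exact Ideal.mul_mem_mul hb hb'
    · rw [map_mul, hbs, hbs']; ring
  · exact ⟨0, 1, by simp, by simp⟩
  · rintro s s' ⟨n, b, hb, hbs⟩ ⟨n', b', hb', hbs'⟩
    refine ⟨n + n', X i ^ n' * b + X i ^ n * b', ?_, ?_⟩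
    · refine Ideal.add_mem _ ?_ ?_
      · rw [add_comm, pow_add]; exact Ideal.mul_mem_mul (Ideal.pow_mem_pow hx1 n') hb
      · rw [pow_add]; exact Ideal.mul_mem_mul (Ideal.pow_mem_pow hx1 n) hb'
    · rw [map_add, map_mul, map_mul, map_pow, map_pow, hΘi, hbs, hbs']; ring
  · exact ⟨0, 0, Submodule.zero_mem _, by simp⟩
  · intro c
    exact ⟨0, algebraMap κ _ c, by simp, by rw [pow_zero, one_mul, AlgHom.commutes]⟩

variable (B : Subalgebra κ (MvPowerSeries (Fin 2) κ))
  (hB : ∀ s, s ∈ B ↔ ∃ (n : ℕ) (b : MvPowerSeries (Fin 2) κ),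
    b ∈ maximalIdeal (MvPowerSeries (Fin 2) κ) ^ n ∧ Θ b = X i ^ n * s)

include hB in
/-- `Θ` lands in the chart subalgebra. [folklore] -/
theorem apply_mem_chart (b : MvPowerSeries (Fin 2) κ) : Θ b ∈ B :=
  (hB _).mpr ⟨0, b, by simp, by simp⟩

include hB hΘi in
/-- `X i` lies in the chart subalgebra. [folklore] -/
theorem X_self_mem_chart : (X i : MvPowerSeries (Fin 2) κ) ∈ B := by
  have := apply_mem_chart Θ B hB (X i); rwa [hΘi] at this

include hB hΘi hΘj in
/-- `X j` lies in the chart subalgebra (`x · X j = Θ (X j − t · X i)`). [folklore] -/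
theorem X_other_mem_chart : (X j : MvPowerSeries (Fin 2) κ) ∈ B := by
  refine (hB _).mpr ⟨1, X j - C t * X i, ?_, ?_⟩
  · rw [pow_one]
    exact Ideal.sub_mem _ (X_mem_maximalIdeal κ (Fin 2) j)
      (Ideal.mul_mem_left _ _ (X_mem_maximalIdeal κ (Fin 2) i))
  · rw [map_sub, map_mul, algHom_C, hΘi, hΘj, pow_one]; ring

end Chart


section Count

variable {i j : Fin 2} (hij : j ≠ i) (t : κ)
  (Θ : MvPowerSeries (Fin 2) κ →ₐ[κ] MvPowerSeries (Fin 2) κ)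
  (hΘi : Θ (X i) = X i) (hΘj : Θ (X j) = X i * (X j + C t))
  (B : Subalgebra κ (MvPowerSeries (Fin 2) κ))
  (hB : ∀ s, s ∈ B ↔ ∃ (n : ℕ) (b : MvPowerSeries (Fin 2) κ),
    b ∈ maximalIdeal (MvPowerSeries (Fin 2) κ) ^ n ∧ Θ b = X i ^ n * s)
  [Algebra (MvPowerSeries (Fin 2) κ) B]
  (halg : ∀ b, ((algebraMap (MvPowerSeries (Fin 2) κ) B b : B) : MvPowerSeries (Fin 2) κ) = Θ b)

/-! ### The hypotheses of Huneke–Swanson 14.3.4 for the chart algebra `R → B` -/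

include hij hΘi hΘj halg in
/-- The structure map `R → B` (that is, `Θ`) is injective. [folklore] -/
theorem algebraMap_chart_injective : Function.Injective (algebraMap (MvPowerSeries (Fin 2) κ) B) := by
  intro a b h
  apply injective_of_chart hij t Θ hΘi hΘj
  rw [← halg, ← halg, h]

include hΘi halg in
/-- `X i` is a non-zero-divisor of the chart algebra. [folklore] -/
theorem algebraMap_X_mem_nonZeroDivisors :
    algebraMap (MvPowerSeries (Fin 2) κ) B (X i) ∈ nonZeroDivisors B := by
  refine mem_nonZeroDivisors_of_ne_zero fun h0 => ?_
  have h1 := congrArg (Subtype.val) h0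
  rw [halg, hΘi] at h1
  have h2 := congrArg (coeff (single i 1)) h1
  classical
  rw [coeff_X, if_pos rfl] at h2
  simp at h2

include hij hΘi hΘj hB halg in
/-- `𝔪 B = (X i) B`. [folklore] -/
theorem map_maximalIdeal_chart :
    (maximalIdeal (MvPowerSeries (Fin 2) κ)).map (algebraMap (MvPowerSeries (Fin 2) κ) B) =
      Ideal.span {algebraMap (MvPowerSeries (Fin 2) κ) B (X i)} := by
  have hyB : (X j : MvPowerSeries (Fin 2) κ) + C t ∈ B :=
    B.add_mem (X_other_mem_chart t Θ hΘi hΘj B hB) (B.algebraMap_mem t)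
  apply le_antisymm
  · rw [maximalIdeal_eq_span_pair hij, Ideal.map_span, Ideal.span_le]
    rintro _ ⟨g, hg, rfl⟩
    simp only [Set.mem_insert_iff, Set.mem_singleton_iff] at hg
    rcases hg with rfl | rfl
    · exact Ideal.mem_span_singleton_self _
    · rw [SetLike.mem_coe, Ideal.mem_span_singleton']
      refine ⟨⟨X j + C t, hyB⟩, Subtype.ext ?_⟩
      rw [Subalgebra.coe_mul, halg, halg, hΘi, hΘj]; ring
  · rw [Ideal.span_singleton_le_iff_mem]
    exact Ideal.mem_map_of_mem _ (X_mem_maximalIdeal κ (Fin 2) i)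

include hΘi hB halg in
/-- Every element of the chart algebra is `x⁻ⁿ b` with `b ∈ 𝔪ⁿ`. [folklore] -/
theorem exists_pow_mul_eq_chart (s : B) :
    ∃ (n : ℕ) (b : MvPowerSeries (Fin 2) κ), b ∈ maximalIdeal (MvPowerSeries (Fin 2) κ) ^ n ∧
      algebraMap (MvPowerSeries (Fin 2) κ) B b = algebraMap (MvPowerSeries (Fin 2) κ) B (X i) ^ n * s := by
  obtain ⟨n, b, hb, hbs⟩ := (hB s).mp s.2
  refine ⟨n, b, hb, Subtype.ext ?_⟩
  rw [halg, hbs, Subalgebra.coe_mul, Subalgebra.coe_pow, halg, hΘi]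

include halg in
/-- The composite `B ⊆ R` after `R → B` is `Θ`; hence extended ideals map back into `Θ(J) R`:
for `s ∈ J B`, `(s : R) ∈ J.map Θ`. [folklore] -/
theorem coe_mem_map_of_mem_map {J : Ideal (MvPowerSeries (Fin 2) κ)} {s : B}
    (hs : s ∈ J.map (algebraMap (MvPowerSeries (Fin 2) κ) B)) :
    (s : MvPowerSeries (Fin 2) κ) ∈ J.map (Θ : MvPowerSeries (Fin 2) κ →+* MvPowerSeries (Fin 2) κ) := by
  have hcomp : (B.val : B →+* MvPowerSeries (Fin 2) κ).comp (algebraMap (MvPowerSeries (Fin 2) κ) B) =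
      (Θ : MvPowerSeries (Fin 2) κ →+* MvPowerSeries (Fin 2) κ) := by
    exact RingHom.ext fun b => halg b
  have := Ideal.mem_map_of_mem (B.val : B →+* MvPowerSeries (Fin 2) κ) hs
  rwa [Ideal.map_map, hcomp] at this

end Count


section MainCount

variable {i j : Fin 2} (hij : j ≠ i) (t : κ)
  (Θ : MvPowerSeries (Fin 2) κ →ₐ[κ] MvPowerSeries (Fin 2) κ)
  (hΘi : Θ (X i) = X i) (hΘj : Θ (X j) = X i * (X j + C t))
  (B : Subalgebra κ (MvPowerSeries (Fin 2) κ))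
  (hB : ∀ s, s ∈ B ↔ ∃ (n : ℕ) (b : MvPowerSeries (Fin 2) κ),
    b ∈ maximalIdeal (MvPowerSeries (Fin 2) κ) ^ n ∧ Θ b = X i ^ n * s)
  [Algebra (MvPowerSeries (Fin 2) κ) B]
  (halg : ∀ b, ((algebraMap (MvPowerSeries (Fin 2) κ) B b : B) : MvPowerSeries (Fin 2) κ) = Θ b)
  (hBsurj : ∀ J' : Ideal (MvPowerSeries (Fin 2) κ), Module.Finite κ (MvPowerSeries (Fin 2) κ ⧸ J') →
    Function.Surjective fun b : B => Ideal.Quotient.mk J' (b : MvPowerSeries (Fin 2) κ))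

include hij hΘi hΘj hB halg in
/-- **Huneke–Swanson 14.3.4 for the chart algebra, as a `κ`-linear isomorphism.** Let `J ≤ 𝔪ʳ`
(`r ≥ 1`) contain some `f ∉ (X i) + 𝔪ʳ⁺¹`. Then `B ⧸ J^B ≅ 𝔪ʳ / J^c` over `κ`, where
`J^B = (J B : xʳ)` is the transform of `J` in the chart algebra `B` and `J^c = J B ∩ R` its contraction
(`B/J^B —·xʳ→ xʳB/JB = 𝔪ʳB/JB`, onto which `𝔪ʳ` surjects with kernel `J^c`).
[cite: HunekeSwanson2006, Lemma 14.3.4] -/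
theorem nonempty_quotient_colon_equiv {r : ℕ} (hr : 1 ≤ r)
    {J : Ideal (MvPowerSeries (Fin 2) κ)} (hJ : J ≤ maximalIdeal (MvPowerSeries (Fin 2) κ) ^ r)
    {f : MvPowerSeries (Fin 2) κ} (hfJ : f ∈ J)
    (hf : f ∉ Ideal.span {(X i : MvPowerSeries (Fin 2) κ)} ⊔ maximalIdeal (MvPowerSeries (Fin 2) κ) ^ (r + 1)) :
    Nonempty ((B ⧸ ((J.map (algebraMap (MvPowerSeries (Fin 2) κ) B)).colon
        {algebraMap (MvPowerSeries (Fin 2) κ) B (X i) ^ r}).restrictScalars κ) ≃ₗ[κ]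
      ↥((Submodule.map (Submodule.mkQ ((J.map (algebraMap (MvPowerSeries (Fin 2) κ) B)).comap
        (algebraMap (MvPowerSeries (Fin 2) κ) B))) (maximalIdeal (MvPowerSeries (Fin 2) κ) ^ r)).restrictScalars κ)) := by
  classical
  haveI : IsRegularLocalRing (MvPowerSeries (Fin 2) κ) := isRegularLocalRing_mvPowerSeries κ (Fin 2)
  -- notation (`𝔪` the maximal ideal, `x = X i`, `φ = Θ : R → B`, `IS = J B`, `Jc = J B ∩ R`)
  let 𝔪 : Ideal (MvPowerSeries (Fin 2) κ) := maximalIdeal (MvPowerSeries (Fin 2) κ)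
  let φ : MvPowerSeries (Fin 2) κ →+* B := algebraMap (MvPowerSeries (Fin 2) κ) B
  let x : MvPowerSeries (Fin 2) κ := X i
  let IS : Ideal B := J.map φ
  let Jc : Ideal (MvPowerSeries (Fin 2) κ) := IS.comap φ
  change Nonempty ((B ⧸ (IS.colon {φ x ^ r}).restrictScalars κ) ≃ₗ[κ]
    ↥((Submodule.map (Submodule.mkQ Jc) (𝔪 ^ r)).restrictScalars κ))
  -- the Huneke–Swanson hypotheses
  have hx1 : x ∈ 𝔪 := X_mem_maximalIdeal κ (Fin 2) i
  have hx2 : x ∉ 𝔪 ^ 2 := X_not_mem_maximalIdeal_sq i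
  have hxS : φ x ∈ nonZeroDivisors B := algebraMap_X_mem_nonZeroDivisors Θ hΘi B halg
  have hmS : 𝔪.map φ = Ideal.span {φ x} := map_maximalIdeal_chart hij t Θ hΘi hΘj B hB halg
  have hS2 : ∀ s : B, ∃ (n : ℕ) (b : MvPowerSeries (Fin 2) κ), b ∈ 𝔪 ^ n ∧ φ b = φ x ^ n * s :=
    exists_pow_mul_eq_chart Θ hΘi B hB halg
  have hxy : Ideal.span {x, X j} = 𝔪 := (maximalIdeal_eq_span_pair hij).symm
  have h6 : 𝔪 ^ r ≤ J ⊔ Ideal.span {x} := pow_le_sup_span_singleton_of_not_mem hxy hfJ (hJ hfJ) hf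
  have hφc : ∀ c : κ, φ (algebraMap κ (MvPowerSeries (Fin 2) κ) c) = algebraMap κ B c := fun c =>
    Subtype.ext (by rw [halg, AlgHom.commutes]; rfl)
  -- `θ : 𝔪ʳ → B ⧸ J B`, `b ↦ Θ b`
  let θ : ↥((𝔪 ^ r).restrictScalars κ) →ₗ[κ] (B ⧸ IS) :=
    { toFun := fun b => Ideal.Quotient.mk IS (φ (b : MvPowerSeries (Fin 2) κ))
      map_add' := fun b b' => by rw [Submodule.coe_add, φ.map_add, (Ideal.Quotient.mk IS).map_add]
      map_smul' := fun c b => by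
        rw [RingHom.id_apply, Submodule.coe_smul_of_tower, Algebra.smul_def, φ.map_mul,
          (Ideal.Quotient.mk IS).map_mul, hφc, Ideal.Quotient.mk_algebraMap, ← Algebra.smul_def] }
  have hθ : ∀ b, θ b = Ideal.Quotient.mk IS (φ (b : MvPowerSeries (Fin 2) κ)) := fun b => rfl
  -- `η : 𝔪ʳ → R ⧸ J^c`, `b ↦ b`
  let η : ↥((𝔪 ^ r).restrictScalars κ) →ₗ[κ] (MvPowerSeries (Fin 2) κ ⧸ Jc) :=
    ((Submodule.mkQ Jc).restrictScalars κ).comp ((𝔪 ^ r).restrictScalars κ).subtype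
  have hη : ∀ b, η b = Ideal.Quotient.mk Jc (b : MvPowerSeries (Fin 2) κ) := fun b => rfl
  -- same kernels
  have hker : LinearMap.ker θ = LinearMap.ker η := by
    ext b
    rw [LinearMap.mem_ker, LinearMap.mem_ker, hθ, hη, Ideal.Quotient.eq_zero_iff_mem,
      Ideal.Quotient.eq_zero_iff_mem, Ideal.mem_comap]
  -- `range η = 𝔪ʳ/J^c`
  have hrangeη : LinearMap.range η = (Submodule.map (Submodule.mkQ Jc) (𝔪 ^ r)).restrictScalars κ := by
    apply le_antisymm
    · rintro _ ⟨b, rfl⟩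
      exact ⟨b, b.2, rfl⟩
    · rintro _ ⟨b, hb, rfl⟩
      exact ⟨⟨b, hb⟩, rfl⟩
  -- upstairs: `μx : B → B/J B`, `s ↦ xʳ s`, kernel `J^B = (J B : xʳ)`, range = range θ
  let μx : B →ₗ[κ] (B ⧸ IS) :=
    (Ideal.Quotient.mkₐ κ IS).toLinearMap.comp (LinearMap.mulLeft κ (φ x ^ r))
  have hμx : ∀ s, μx s = Ideal.Quotient.mk IS (φ x ^ r * s) := fun s => rfl
  have hkerμ : LinearMap.ker μx = (IS.colon {φ x ^ r}).restrictScalars κ := by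
    ext s
    rw [LinearMap.mem_ker, hμx, Ideal.Quotient.eq_zero_iff_mem, Submodule.restrictScalars_mem,
      Submodule.mem_colon_singleton, smul_eq_mul, mul_comm]
  have hrangeμ : LinearMap.range μx = LinearMap.range θ := by
    apply le_antisymm
    · rintro _ ⟨s, rfl⟩
      have hs' : φ x ^ r * s ∈ (𝔪 ^ r).map φ := by
        rw [map_pow_maximalIdeal_eq_span hmS]
        exact Ideal.mul_mem_right _ _ (Ideal.mem_span_singleton_self _)
      obtain ⟨m₀, hm₀, hdiff⟩ := exists_sub_algebraMap_mem_map hx1 hx2 hxS hmS hS2 hr hJ h6 hs'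
      refine ⟨⟨m₀, hm₀⟩, ?_⟩
      rw [hθ, hμx]
      exact ((Ideal.Quotient.eq).mpr hdiff).symm
    · rintro _ ⟨b, rfl⟩
      have hb' : φ (b : MvPowerSeries (Fin 2) κ) ∈ Ideal.span {φ x ^ r} := by
        rw [← map_pow_maximalIdeal_eq_span hmS]
        exact Ideal.mem_map_of_mem _ b.2
      obtain ⟨s, hs⟩ := Ideal.mem_span_singleton'.mp hb'
      refine ⟨s, ?_⟩
      rw [hμx, hθ, ← hs, mul_comm]
  -- compose: `B/J^B ≃ range μx = range θ ≃ 𝔪ʳ/ker θ = 𝔪ʳ/ker η ≃ range η = 𝔪ʳ/J^c`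
  exact ⟨((((Submodule.quotEquivOfEq _ _ hkerμ).symm.trans μx.quotKerEquivRange).trans
      (LinearEquiv.ofEq _ _ hrangeμ)).trans θ.quotKerEquivRange.symm).trans
    (((Submodule.quotEquivOfEq _ _ hker).trans η.quotKerEquivRange).trans (LinearEquiv.ofEq _ _ hrangeη))⟩

include hij hΘi hΘj hB halg hBsurj in
/-- **Huneke–Swanson 14.3.4, counted over `κ`, for the chart algebra.** Let `J ≤ 𝔪ʳ` (`r ≥ 1`) have
finite colength and contain some `f ∉ (X i) + 𝔪ʳ⁺¹`; let `J'` satisfy `Θ(J) R = (X i)ʳ · J'` and have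
finite colength. Then `dim_κ R/J' + dim_κ R/𝔪ʳ ≤ dim_κ R/J^c` for the contraction
`J^c = J B ∩ R` of `J` from the chart algebra `B`. [cite: HunekeSwanson2006, Lemma 14.3.4] -/
theorem finrank_quotient_weakTransform_add_le {r : ℕ} (hr : 1 ≤ r)
    {J : Ideal (MvPowerSeries (Fin 2) κ)} (hJ : J ≤ maximalIdeal (MvPowerSeries (Fin 2) κ) ^ r)
    {f : MvPowerSeries (Fin 2) κ} (hfJ : f ∈ J)
    (hf : f ∉ Ideal.span {(X i : MvPowerSeries (Fin 2) κ)} ⊔ maximalIdeal (MvPowerSeries (Fin 2) κ) ^ (r + 1))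
    [Module.Finite κ (MvPowerSeries (Fin 2) κ ⧸ J)]
    {J' : Ideal (MvPowerSeries (Fin 2) κ)}
    (hJ' : J.map (Θ : MvPowerSeries (Fin 2) κ →+* MvPowerSeries (Fin 2) κ) =
      Ideal.span {(X i : MvPowerSeries (Fin 2) κ) ^ r} * J')
    [Module.Finite κ (MvPowerSeries (Fin 2) κ ⧸ J')] :
    finrank κ (MvPowerSeries (Fin 2) κ ⧸ J') + finrank κ (MvPowerSeries (Fin 2) κ ⧸ maximalIdeal (MvPowerSeries (Fin 2) κ) ^ r) ≤
      finrank κ (MvPowerSeries (Fin 2) κ ⧸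
        (J.map (algebraMap (MvPowerSeries (Fin 2) κ) B)).comap (algebraMap (MvPowerSeries (Fin 2) κ) B)) := by
  classical
  -- notation
  let 𝔪 : Ideal (MvPowerSeries (Fin 2) κ) := maximalIdeal (MvPowerSeries (Fin 2) κ)
  let φ : MvPowerSeries (Fin 2) κ →+* B := algebraMap (MvPowerSeries (Fin 2) κ) B
  let x : MvPowerSeries (Fin 2) κ := X i
  let IS : Ideal B := J.map φ
  let Jc : Ideal (MvPowerSeries (Fin 2) κ) := IS.comap φ
  change finrank κ (MvPowerSeries (Fin 2) κ ⧸ J') + finrank κ (MvPowerSeries (Fin 2) κ ⧸ 𝔪 ^ r) ≤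
    finrank κ (MvPowerSeries (Fin 2) κ ⧸ Jc)
  obtain ⟨e⟩ := nonempty_quotient_colon_equiv hij t Θ hΘi hΘj B hB halg hr hJ hfJ hf
  change (B ⧸ (IS.colon {φ x ^ r}).restrictScalars κ) ≃ₗ[κ]
    ↥((Submodule.map (Submodule.mkQ Jc) (𝔪 ^ r)).restrictScalars κ) at e
  -- `J ≤ J^c ≤ 𝔪ʳ`, finiteness, and the count downstairs
  have hJJc : J ≤ Jc := Ideal.le_comap_map
  haveI hfinJc : Module.Finite κ (MvPowerSeries (Fin 2) κ ⧸ Jc) := finite_quotient_of_le (κ := κ) hJJc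
  have hJcm : Jc ≤ 𝔪 ^ r := by
    haveI : IsRegularLocalRing (MvPowerSeries (Fin 2) κ) := isRegularLocalRing_mvPowerSeries κ (Fin 2)
    have hcm := comap_map_pow_maximalIdeal (X_mem_maximalIdeal κ (Fin 2) i) (X_not_mem_maximalIdeal_sq i)
      (algebraMap_chart_injective hij t Θ hΘi hΘj B halg) (map_maximalIdeal_chart hij t Θ hΘi hΘj B hB halg)
      (exists_pow_mul_eq_chart Θ hΘi B hB halg) r
    calc Jc ≤ ((𝔪 ^ r).map φ).comap φ := Ideal.comap_mono (Ideal.map_mono hJ)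
      _ = 𝔪 ^ r := hcm
  have hcount := finrank_quotient_add_finrank_map (κ := κ) hJcm
  haveI : Module.Finite κ ↥((Submodule.map (Submodule.mkQ Jc) (𝔪 ^ r)).restrictScalars κ) :=
    Module.Finite.of_injective (((Submodule.map (Submodule.mkQ Jc) (𝔪 ^ r)).restrictScalars κ).subtype)
      Subtype.val_injective
  haveI : Module.Finite κ (B ⧸ (IS.colon {φ x ^ r}).restrictScalars κ) := Module.Finite.equiv e.symm
  have hfine : finrank κ (B ⧸ (IS.colon {φ x ^ r}).restrictScalars κ) =
      finrank κ (Submodule.map (Submodule.mkQ Jc) (𝔪 ^ r)) := e.finrank_eq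
  -- the surjection `B ⧸ J^B ↠ R ⧸ J'`
  let Ψ₀ : B →ₗ[κ] (MvPowerSeries (Fin 2) κ ⧸ J') :=
    ((Submodule.mkQ J').restrictScalars κ).comp (B.val.toLinearMap)
  have hΨ₀ : ∀ s : B, Ψ₀ s = Ideal.Quotient.mk J' (s : MvPowerSeries (Fin 2) κ) := fun s => rfl
  have hΨker : (IS.colon {φ x ^ r}).restrictScalars κ ≤ LinearMap.ker Ψ₀ := by
    intro s hs
    rw [Submodule.restrictScalars_mem, Submodule.mem_colon_singleton, smul_eq_mul] at hs
    rw [LinearMap.mem_ker, hΨ₀, Ideal.Quotient.eq_zero_iff_mem]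
    have hmem := coe_mem_map_of_mem_map Θ B halg hs
    rw [Subalgebra.coe_mul, Subalgebra.coe_pow, halg, hΘi, hJ', Ideal.mem_span_singleton_mul] at hmem
    obtain ⟨z, hz, hzeq⟩ := hmem
    have hxr : (x : MvPowerSeries (Fin 2) κ) ^ r ≠ 0 := pow_ne_zero _ (X_ne_zero' (κ := κ) i)
    have : (s : MvPowerSeries (Fin 2) κ) = z := mul_left_cancel₀ hxr (by rw [hzeq, mul_comm])
    rw [this]; exact hz
  let Ψ : (B ⧸ (IS.colon {φ x ^ r}).restrictScalars κ) →ₗ[κ] (MvPowerSeries (Fin 2) κ ⧸ J') :=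
    Submodule.liftQ _ Ψ₀ hΨker
  have hΨsurj : Function.Surjective Ψ := by
    intro y
    obtain ⟨s, hs⟩ := hBsurj J' inferInstance y
    exact ⟨Submodule.Quotient.mk s, hs⟩
  have hfinΨ : finrank κ (MvPowerSeries (Fin 2) κ ⧸ J') ≤
      finrank κ (B ⧸ (IS.colon {φ x ^ r}).restrictScalars κ) := by
    rw [← finrank_top κ (MvPowerSeries (Fin 2) κ ⧸ J'), ← LinearMap.range_eq_top.mpr hΨsurj]
    exact LinearMap.finrank_range_le Ψ
  -- assemble
  rw [hfine] at hfinΨ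
  omega

end MainCount

end Literature.AlgebraicGeometry.Resolution.PlaneChart

end
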